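import Mathlib
import Summits.Ventures.PercRepro2.V2SP
import Summits.Ventures.PercRepro2.HallOffFrame
import Summits.Ventures.PercRepro2.HallOffAxis
import Summits.Ventures.PercRepro2.Tail2DCount
import Summits.Ventures.PercRepro2.Tail2DThreePoint
import Summits.Ventures.PercRepro2.Tail2DP2Series
import Summits.Ventures.PercRepro2.Tail2DDisjointPaths
import Summits.Ventures.PercRepro2.Tail2DP2SeriesSP
import Summits.Ventures.PercRepro2.Tail2DAxisUnimodal
import Summits.Ventures.PercRepro2.Tail2DOffAxis31

/-!
# The whole row `j = 1` of the off-axis family: `T(a,1) ≤ T(a−1,2)` for EVERY `a ≥ 3` on every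
series–parallel network (seat mine-b, cell pub-perc-repro2)

For every pattern `s` of the cell's grammar, uniformly two-coloured, and every `a ≥ 3`,

  `#{r ≥ a ∧ b ≥ 1} ≤ #{r ≥ a−1 ∧ b ≥ 2}`   (`t_row1`):

`a` edge-disjoint red paths together with a blue path are rarer than `a−1` edge-disjoint red paths
together with two edge-disjoint blue paths — the row `j = 1` of the anti-diagonal unimodality
`T(a, j) ≤ T(a−1, j+1)` of the two-colour flow tail, whose members `3 ≤ a ≤ 8` were landed one by one
(`t31_le_t22`, `t41_le_t32`, …, `t81_le_t72`) through one bilinear certificate with products of two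
hypotheses.  Here the whole row is proved at once, and WITHOUT products: in the weight vocabulary of
`HallOffFrame.lean`, `phi a j r b = [r+1 = a ∧ j+1 ≤ b] − [a ≤ r ∧ b = j]`, the inequality at level `a`
is `0 ≤ Σ_x phi a 1 (r x) (b x)` (`row_iff`), and for `a ≥ 4` the weight of a PARALLEL composition
dominates pointwise a sum of eight products (hypothesis of one factor) × (non-negative weight of the
other factor) (`phi_row_par_ge`):

  `phi a 1 (r+r') (b+b') ≥ [b' = 0 ∧ r' ≤ a−3]·phi (a−r') 1 r b + [b' = 0 ∧ r' ≥ a−2]·phi 2 1 r b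
                           + [r' = 0 ∧ b' ≥ 1]·phi a 0 r b + [r' = 1 ∧ b' ≥ 1]·phi (a−1) 0 r b + (mirror)`,

where the hypotheses are the row itself at the levels `3 … a` (the induction hypothesis), the level `2`
(count `0`, the colour swap: `sum_phi_two_one`) and the axis family `phi m 0` (`SP.hallFn_phi_axis_count`).
Summing over the product of the configuration spaces gives the parallel step (`sum_phi_row_par`); series
multiplies both tails (`card_tail_ser`); the atoms have flows `≤ 1`.  The member `a = 3`, where the
pointwise certificate does not exist (the two mirror terms `[r' = 1]·phi 2 0` and `[r = 1]·phi 2 0`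
collide on the cell `(1,1) × (1,1)`), is the landed `t31_le_t22`.

The whole row `j = 1` is therefore a theorem on all of SP for every `a`; registry MINE-B.md §37.
-/

namespace Summit.Ventures.PercRepro2.Tail2D

open V2Closure

section Counts

variable (s : V2Closure.SP)

/-- the count of the row weight: `Σ phi a 1 = #{r + 1 = a ∧ b ≥ 2} − #{r ≥ a ∧ b = 1}` -/
lemma sum_phi_row (a : ℕ) :
    ∑ x, phi a 1 (s.rLab x) (s.bLab x)
      = ((Finset.univ.filter (fun y : s.Conf => s.rLab y + 1 = a ∧ 2 ≤ s.bLab y)).card : ℤ)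
        - ((Finset.univ.filter (fun y : s.Conf => a ≤ s.rLab y ∧ s.bLab y = 1)).card : ℤ) := by
  rw [Finset.card_filter, Finset.card_filter]
  push_cast
  rw [← Finset.sum_sub_distrib]
  refine Finset.sum_congr rfl (fun y _ => ?_)
  unfold phi
  split_ifs <;> omega

/-- `#{r ≥ a ∧ b ≥ 1} = #{r ≥ a ∧ b = 1} + #{r ≥ a ∧ b ≥ 2}` -/
lemma card_row_a1_split (a : ℕ) :
    (Finset.univ.filter (fun y : s.Conf => a ≤ s.rLab y ∧ 1 ≤ s.bLab y)).card
      = (Finset.univ.filter (fun y : s.Conf => a ≤ s.rLab y ∧ s.bLab y = 1)).card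
        + (Finset.univ.filter (fun y : s.Conf => a ≤ s.rLab y ∧ 2 ≤ s.bLab y)).card := by
  rw [Finset.card_filter, Finset.card_filter, Finset.card_filter, ← Finset.sum_add_distrib]
  refine Finset.sum_congr rfl (fun y _ => ?_)
  split_ifs <;> omega

/-- `#{r ≥ a−1 ∧ b ≥ 2} = #{r + 1 = a ∧ b ≥ 2} + #{r ≥ a ∧ b ≥ 2}` for `a ≥ 1` -/
lemma card_row_a2_split (a : ℕ) (ha : 1 ≤ a) :
    (Finset.univ.filter (fun y : s.Conf => a - 1 ≤ s.rLab y ∧ 2 ≤ s.bLab y)).card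
      = (Finset.univ.filter (fun y : s.Conf => s.rLab y + 1 = a ∧ 2 ≤ s.bLab y)).card
        + (Finset.univ.filter (fun y : s.Conf => a ≤ s.rLab y ∧ 2 ≤ s.bLab y)).card := by
  rw [Finset.card_filter, Finset.card_filter, Finset.card_filter, ← Finset.sum_add_distrib]
  refine Finset.sum_congr rfl (fun y _ => ?_)
  split_ifs <;> omega

/-- the row inequality at level `a` and the non-negativity of the count of `phi a 1` -/
lemma row_iff (a : ℕ) (ha : 1 ≤ a) :
    (Finset.univ.filter (fun y : s.Conf => a ≤ s.rLab y ∧ 1 ≤ s.bLab y)).card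
        ≤ (Finset.univ.filter (fun y : s.Conf => a - 1 ≤ s.rLab y ∧ 2 ≤ s.bLab y)).card
      ↔ 0 ≤ ∑ x, phi a 1 (s.rLab x) (s.bLab x) := by
  rw [sum_phi_row, card_row_a1_split, card_row_a2_split s a ha]
  constructor <;> intro h <;> omega

/-- the level `2` of the row has count `0`: `#{r = 1 ∧ b ≥ 2} = #{r ≥ 2 ∧ b = 1}` by the colour swap -/
lemma sum_phi_two_one : ∑ x, phi 2 1 (s.rLab x) (s.bLab x) = 0 := by
  rw [sum_phi_row]
  have h := card_swap s (fun r b => 2 ≤ r ∧ b = 1)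
  have e : (Finset.univ.filter (fun y : s.Conf => s.rLab y + 1 = 2 ∧ 2 ≤ s.bLab y))
      = Finset.univ.filter (fun y : s.Conf => 2 ≤ s.bLab y ∧ s.rLab y = 1) := by
    ext y; simp only [Finset.mem_filter, Finset.mem_univ, true_and]; omega
  rw [e, h]; simp

end Counts

section Pointwise

/-- `phi m 1 r b = 0` for `b = 0` -/
lemma phi_one_eq_b0 (m r b : ℕ) (hb : b = 0) : phi m 1 r b = 0 := by
  subst hb; unfold phi; simp

/-- `phi m 1 r b = −[m ≤ r]` for `b = 1` -/
lemma phi_one_eq_b1 (m r b : ℕ) (hb : b = 1) : phi m 1 r b = -(if m ≤ r then (1 : ℤ) else 0) := by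
  subst hb; unfold phi; split_ifs <;> omega

/-- `phi m 1 r b = [r + 1 = m]` for `b ≥ 2` -/
lemma phi_one_eq_b2 (m r b : ℕ) (hb : 2 ≤ b) : phi m 1 r b = (if r + 1 = m then (1 : ℤ) else 0) := by
  unfold phi; split_ifs <;> omega

/-- `phi m 0 r b = −[m ≤ r]` for `b = 0` -/
lemma phi_zero_eq_b0 (m r b : ℕ) (hb : b = 0) : phi m 0 r b = -(if m ≤ r then (1 : ℤ) else 0) := by
  subst hb; unfold phi; split_ifs <;> omega

/-- `phi m 0 r b = [r + 1 = m]` for `b ≥ 1` -/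
lemma phi_zero_eq_b1 (m r b : ℕ) (hb : 1 ≤ b) : phi m 0 r b = (if r + 1 = m then (1 : ℤ) else 0) := by
  unfold phi; split_ifs <;> omega

set_option maxHeartbeats 3200000 in
/-- **the pointwise certificate of the parallel step of the row `j = 1`** (`a ≥ 4`): the row weight of a
sum of labels dominates eight products (hypothesis of one factor) × (non-negative weight of the other) -/
theorem phi_row_par_ge (a r b r' b' : ℕ) (ha : 4 ≤ a) :
    (if b' = 0 ∧ r' + 3 ≤ a then (1 : ℤ) else 0) * phi (a - r') 1 r b
    + (if b = 0 ∧ r + 3 ≤ a then (1 : ℤ) else 0) * phi (a - r) 1 r' b'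
    + (if b' = 0 ∧ a ≤ r' + 2 then (1 : ℤ) else 0) * phi 2 1 r b
    + (if b = 0 ∧ a ≤ r + 2 then (1 : ℤ) else 0) * phi 2 1 r' b'
    + (if r' = 0 ∧ 1 ≤ b' then (1 : ℤ) else 0) * phi a 0 r b
    + (if r' = 1 ∧ 1 ≤ b' then (1 : ℤ) else 0) * phi (a - 1) 0 r b
    + (if r = 0 ∧ 1 ≤ b then (1 : ℤ) else 0) * phi a 0 r' b'
    + (if r = 1 ∧ 1 ≤ b then (1 : ℤ) else 0) * phi (a - 1) 0 r' b'
    ≤ phi a 1 (r + r') (b + b') := by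
  rcases (by omega : b = 0 ∨ b = 1 ∨ 2 ≤ b) with hb | hb | hb <;>
  rcases (by omega : b' = 0 ∨ b' = 1 ∨ 2 ≤ b') with hb' | hb' | hb'
  -- b = 0, b' = 0: every term vanishes
  · rw [phi_one_eq_b0 a (r + r') (b + b') (by omega)]
    simp (disch := omega) only [if_neg, phi_one_eq_b0 _ _ _ hb, phi_one_eq_b0 _ _ _ hb', mul_zero, zero_mul,
      add_zero, le_refl]
  -- b = 0, b' = 1
  · rw [phi_one_eq_b1 a (r + r') (b + b') (by omega)]
    simp (disch := omega) only [if_neg, phi_one_eq_b0 _ _ _ hb, phi_one_eq_b1 _ _ _ hb', phi_zero_eq_b0 _ _ _ hb,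
      mul_zero, zero_mul, add_zero, zero_add]
    rcases (by omega : r' = 0 ∨ r' = 1 ∨ 2 ≤ r') with hr' | hr' | hr' <;>
    rcases (by omega : r + 3 ≤ a ∨ a ≤ r + 2) with hr | hr <;>
    simp (disch := omega) only [if_pos, if_neg, one_mul, zero_mul, mul_one, mul_zero, add_zero, zero_add,
      mul_neg, neg_zero] <;>
    (try split_ifs) <;> omega
  -- b = 0, b' ≥ 2
  · rw [phi_one_eq_b2 a (r + r') (b + b') (by omega)]
    simp (disch := omega) only [if_neg, phi_one_eq_b0 _ _ _ hb, phi_one_eq_b2 _ _ _ hb', phi_zero_eq_b0 _ _ _ hb,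
      mul_zero, zero_mul, add_zero, zero_add]
    rcases (by omega : r' = 0 ∨ r' = 1 ∨ 2 ≤ r') with hr' | hr' | hr' <;>
    rcases (by omega : r + 3 ≤ a ∨ a ≤ r + 2) with hr | hr <;>
    simp (disch := omega) only [if_pos, if_neg, one_mul, zero_mul, mul_one, mul_zero, add_zero, zero_add,
      mul_neg, neg_zero] <;>
    (try split_ifs) <;> omega
  -- b = 1, b' = 0
  · rw [phi_one_eq_b1 a (r + r') (b + b') (by omega)]
    simp (disch := omega) only [if_neg, phi_one_eq_b0 _ _ _ hb', phi_one_eq_b1 _ _ _ hb, phi_zero_eq_b0 _ _ _ hb',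
      mul_zero, zero_mul, add_zero]
    rcases (by omega : r = 0 ∨ r = 1 ∨ 2 ≤ r) with hr | hr | hr <;>
    rcases (by omega : r' + 3 ≤ a ∨ a ≤ r' + 2) with hr' | hr' <;>
    simp (disch := omega) only [if_pos, if_neg, one_mul, zero_mul, mul_one, mul_zero, add_zero, zero_add,
      mul_neg, neg_zero] <;>
    (try split_ifs) <;> omega
  -- b = 1, b' = 1
  · rw [phi_one_eq_b2 a (r + r') (b + b') (by omega)]
    simp (disch := omega) only [if_neg, phi_zero_eq_b1 _ _ _ (by omega : 1 ≤ b), phi_zero_eq_b1 _ _ _ (by omega : 1 ≤ b'),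
      zero_mul, add_zero, zero_add]
    rcases (by omega : r = 0 ∨ r = 1 ∨ 2 ≤ r) with hr | hr | hr <;>
    rcases (by omega : r' = 0 ∨ r' = 1 ∨ 2 ≤ r') with hr' | hr' | hr' <;>
    simp (disch := omega) only [if_pos, if_neg, one_mul, zero_mul, add_zero, zero_add] <;>
    (try split_ifs) <;> omega
  -- b = 1, b' ≥ 2
  · rw [phi_one_eq_b2 a (r + r') (b + b') (by omega)]
    simp (disch := omega) only [if_neg, phi_zero_eq_b1 _ _ _ (by omega : 1 ≤ b), phi_zero_eq_b1 _ _ _ (by omega : 1 ≤ b'),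
      zero_mul, add_zero, zero_add]
    rcases (by omega : r = 0 ∨ r = 1 ∨ 2 ≤ r) with hr | hr | hr <;>
    rcases (by omega : r' = 0 ∨ r' = 1 ∨ 2 ≤ r') with hr' | hr' | hr' <;>
    simp (disch := omega) only [if_pos, if_neg, one_mul, zero_mul, add_zero, zero_add] <;>
    (try split_ifs) <;> omega
  -- b ≥ 2, b' = 0
  · rw [phi_one_eq_b2 a (r + r') (b + b') (by omega)]
    simp (disch := omega) only [if_neg, phi_one_eq_b0 _ _ _ hb', phi_one_eq_b2 _ _ _ hb, phi_zero_eq_b0 _ _ _ hb',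
      mul_zero, zero_mul, add_zero]
    rcases (by omega : r = 0 ∨ r = 1 ∨ 2 ≤ r) with hr | hr | hr <;>
    rcases (by omega : r' + 3 ≤ a ∨ a ≤ r' + 2) with hr' | hr' <;>
    simp (disch := omega) only [if_pos, if_neg, one_mul, zero_mul, mul_one, mul_zero, add_zero, zero_add,
      mul_neg, neg_zero] <;>
    (try split_ifs) <;> omega
  -- b ≥ 2, b' = 1
  · rw [phi_one_eq_b2 a (r + r') (b + b') (by omega)]
    simp (disch := omega) only [if_neg, phi_zero_eq_b1 _ _ _ (by omega : 1 ≤ b), phi_zero_eq_b1 _ _ _ (by omega : 1 ≤ b'),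
      zero_mul, add_zero, zero_add]
    rcases (by omega : r = 0 ∨ r = 1 ∨ 2 ≤ r) with hr | hr | hr <;>
    rcases (by omega : r' = 0 ∨ r' = 1 ∨ 2 ≤ r') with hr' | hr' | hr' <;>
    simp (disch := omega) only [if_pos, if_neg, one_mul, zero_mul, add_zero, zero_add] <;>
    (try split_ifs) <;> omega
  -- b ≥ 2, b' ≥ 2
  · rw [phi_one_eq_b2 a (r + r') (b + b') (by omega)]
    simp (disch := omega) only [if_neg, phi_zero_eq_b1 _ _ _ (by omega : 1 ≤ b), phi_zero_eq_b1 _ _ _ (by omega : 1 ≤ b'),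
      zero_mul, add_zero, zero_add]
    rcases (by omega : r = 0 ∨ r = 1 ∨ 2 ≤ r) with hr | hr | hr <;>
    rcases (by omega : r' = 0 ∨ r' = 1 ∨ 2 ≤ r') with hr' | hr' | hr' <;>
    simp (disch := omega) only [if_pos, if_neg, one_mul, zero_mul, add_zero, zero_add] <;>
    (try split_ifs) <;> omega

end Pointwise

section Product

variable (s t : V2Closure.SP)

/-- a non-negative constant times a non-negative sum over the first factor, summed over the product -/
lemma sum_prod_wt_fst (w : t.Conf → ℤ) (hw : ∀ y, 0 ≤ w y) (h : t.Conf → s.Conf → ℤ)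
    (hh : ∀ y, w y ≠ 0 → 0 ≤ ∑ x, h y x) :
    0 ≤ ∑ p : s.Conf × t.Conf, w p.2 * h p.2 p.1 := by
  rw [Fintype.sum_prod_type_right]
  refine Finset.sum_nonneg (fun y _ => ?_)
  have e := Finset.mul_sum (Finset.univ : Finset s.Conf) (fun x => h y x) (w y)
  dsimp only
  rw [← e]
  by_cases hy : w y = 0
  · rw [hy]; simp
  · exact mul_nonneg (hw y) (hh y hy)

/-- a non-negative constant times a non-negative sum over the second factor, summed over the product -/
lemma sum_prod_wt_snd (w : s.Conf → ℤ) (hw : ∀ x, 0 ≤ w x) (h : s.Conf → t.Conf → ℤ)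
    (hh : ∀ x, w x ≠ 0 → 0 ≤ ∑ y, h x y) :
    0 ≤ ∑ p : s.Conf × t.Conf, w p.1 * h p.1 p.2 := by
  rw [Fintype.sum_prod_type]
  refine Finset.sum_nonneg (fun x _ => ?_)
  have e := Finset.mul_sum (Finset.univ : Finset t.Conf) (fun y => h x y) (w x)
  dsimp only
  rw [← e]
  by_cases hx : w x = 0
  · rw [hx]; simp
  · exact mul_nonneg (hw x) (hh x hx)

/-- **the parallel step of the row `j = 1`** (`a ≥ 4`): if the counts of `phi m 1` are non-negative on both
factors for `3 ≤ m ≤ a`, the count of `phi a 1` is non-negative on the parallel composition -/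
theorem sum_phi_row_par (a : ℕ) (ha : 4 ≤ a)
    (hs : ∀ m, 3 ≤ m → m ≤ a → 0 ≤ ∑ x, phi m 1 (s.rLab x) (s.bLab x))
    (ht : ∀ m, 3 ≤ m → m ≤ a → 0 ≤ ∑ y, phi m 1 (t.rLab y) (t.bLab y)) :
    0 ≤ ∑ p, phi a 1 ((V2Closure.SP.par s t).rLab p) ((V2Closure.SP.par s t).bLab p) := by
  -- the eight products, summed over the product of the configuration spaces
  have h1 := sum_prod_wt_fst s t (fun y => if t.bLab y = 0 ∧ t.rLab y + 3 ≤ a then (1 : ℤ) else 0)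
    (fun y => by split_ifs <;> simp) (fun y x => phi (a - t.rLab y) 1 (s.rLab x) (s.bLab x))
    (fun y hy => by
      split_ifs at hy with h
      · exact hs (a - t.rLab y) (by omega) (by omega)
      · exact absurd rfl hy)
  have h2 := sum_prod_wt_snd s t (fun x => if s.bLab x = 0 ∧ s.rLab x + 3 ≤ a then (1 : ℤ) else 0)
    (fun x => by split_ifs <;> simp) (fun x y => phi (a - s.rLab x) 1 (t.rLab y) (t.bLab y))
    (fun x hx => by
      split_ifs at hx with h
      · exact ht (a - s.rLab x) (by omega) (by omega)
      · exact absurd rfl hx)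
  have h3 := sum_prod_wt_fst s t (fun y => if t.bLab y = 0 ∧ a ≤ t.rLab y + 2 then (1 : ℤ) else 0)
    (fun y => by split_ifs <;> simp) (fun _ x => phi 2 1 (s.rLab x) (s.bLab x))
    (fun y _ => by rw [sum_phi_two_one s])
  have h4 := sum_prod_wt_snd s t (fun x => if s.bLab x = 0 ∧ a ≤ s.rLab x + 2 then (1 : ℤ) else 0)
    (fun x => by split_ifs <;> simp) (fun _ y => phi 2 1 (t.rLab y) (t.bLab y))
    (fun x _ => by rw [sum_phi_two_one t])
  have h5 := sum_prod_wt_fst s t (fun y => if t.rLab y = 0 ∧ 1 ≤ t.bLab y then (1 : ℤ) else 0)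
    (fun y => by split_ifs <;> simp) (fun _ x => phi a 0 (s.rLab x) (s.bLab x))
    (fun y _ => SP.hallFn_phi_axis_count s a (by omega))
  have h6 := sum_prod_wt_fst s t (fun y => if t.rLab y = 1 ∧ 1 ≤ t.bLab y then (1 : ℤ) else 0)
    (fun y => by split_ifs <;> simp) (fun _ x => phi (a - 1) 0 (s.rLab x) (s.bLab x))
    (fun y _ => SP.hallFn_phi_axis_count s (a - 1) (by omega))
  have h7 := sum_prod_wt_snd s t (fun x => if s.rLab x = 0 ∧ 1 ≤ s.bLab x then (1 : ℤ) else 0)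
    (fun x => by split_ifs <;> simp) (fun _ y => phi a 0 (t.rLab y) (t.bLab y))
    (fun x _ => SP.hallFn_phi_axis_count t a (by omega))
  have h8 := sum_prod_wt_snd s t (fun x => if s.rLab x = 1 ∧ 1 ≤ s.bLab x then (1 : ℤ) else 0)
    (fun x => by split_ifs <;> simp) (fun _ y => phi (a - 1) 0 (t.rLab y) (t.bLab y))
    (fun x _ => SP.hallFn_phi_axis_count t (a - 1) (by omega))
  -- the pointwise certificate, summed
  have key : ∀ p : s.Conf × t.Conf,
      (if t.bLab p.2 = 0 ∧ t.rLab p.2 + 3 ≤ a then (1 : ℤ) else 0) * phi (a - t.rLab p.2) 1 (s.rLab p.1) (s.bLab p.1)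
      + (if s.bLab p.1 = 0 ∧ s.rLab p.1 + 3 ≤ a then (1 : ℤ) else 0) * phi (a - s.rLab p.1) 1 (t.rLab p.2) (t.bLab p.2)
      + (if t.bLab p.2 = 0 ∧ a ≤ t.rLab p.2 + 2 then (1 : ℤ) else 0) * phi 2 1 (s.rLab p.1) (s.bLab p.1)
      + (if s.bLab p.1 = 0 ∧ a ≤ s.rLab p.1 + 2 then (1 : ℤ) else 0) * phi 2 1 (t.rLab p.2) (t.bLab p.2)
      + (if t.rLab p.2 = 0 ∧ 1 ≤ t.bLab p.2 then (1 : ℤ) else 0) * phi a 0 (s.rLab p.1) (s.bLab p.1)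
      + (if t.rLab p.2 = 1 ∧ 1 ≤ t.bLab p.2 then (1 : ℤ) else 0) * phi (a - 1) 0 (s.rLab p.1) (s.bLab p.1)
      + (if s.rLab p.1 = 0 ∧ 1 ≤ s.bLab p.1 then (1 : ℤ) else 0) * phi a 0 (t.rLab p.2) (t.bLab p.2)
      + (if s.rLab p.1 = 1 ∧ 1 ≤ s.bLab p.1 then (1 : ℤ) else 0) * phi (a - 1) 0 (t.rLab p.2) (t.bLab p.2)
      ≤ phi a 1 ((V2Closure.SP.par s t).rLab p) ((V2Closure.SP.par s t).bLab p) := by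
    intro p
    exact phi_row_par_ge a (s.rLab p.1) (s.bLab p.1) (t.rLab p.2) (t.bLab p.2) ha
  calc (0 : ℤ) ≤ _ := add_nonneg (add_nonneg (add_nonneg (add_nonneg (add_nonneg (add_nonneg (add_nonneg h1 h2) h3) h4) h5) h6) h7) h8
    _ = ∑ p : s.Conf × t.Conf, (_ + _ + _ + _ + _ + _ + _ + _) := by
        simp only [Finset.sum_add_distrib]
    _ ≤ ∑ p : s.Conf × t.Conf, phi a 1 ((V2Closure.SP.par s t).rLab p) ((V2Closure.SP.par s t).bLab p) :=
        Finset.sum_le_sum (fun p _ => key p)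

end Product

/-- **the whole row `j = 1` on every pattern of the grammar**: `a` edge-disjoint red paths together with a
blue path are rarer than `a−1` edge-disjoint red paths together with two edge-disjoint blue paths, for
EVERY `a ≥ 3`: `T(a,1) ≤ T(a−1,2)`. -/
theorem t_row1 : ∀ (s : V2Closure.SP) (a : ℕ), 3 ≤ a →
    (Finset.univ.filter (fun y : s.Conf => a ≤ s.rLab y ∧ 1 ≤ s.bLab y)).card
      ≤ (Finset.univ.filter (fun y : s.Conf => a - 1 ≤ s.rLab y ∧ 2 ≤ s.bLab y)).card
  | .free, a, ha => by
    rw [Finset.card_eq_zero.2 (Finset.filter_eq_empty_iff.2 (fun y _ => by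
      have := atom_rLab_le_one .free (Or.inl rfl) y; omega))]
    exact Nat.zero_le _
  | .pin, a, ha => by
    rw [Finset.card_eq_zero.2 (Finset.filter_eq_empty_iff.2 (fun y _ => by
      have := atom_rLab_le_one .pin (Or.inr (Or.inl rfl)) y; omega))]
    exact Nat.zero_le _
  | .absent, a, ha => by
    rw [Finset.card_eq_zero.2 (Finset.filter_eq_empty_iff.2 (fun y _ => by
      have := atom_rLab_le_one .absent (Or.inr (Or.inr rfl)) y; omega))]
    exact Nat.zero_le _
  | .ser s t, a, ha => by
    rw [card_tail_ser, card_tail_ser]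
    exact Nat.mul_le_mul (t_row1 s a ha) (t_row1 t a ha)
  | .par s t, a, ha => by
    rcases (by omega : a = 3 ∨ 4 ≤ a) with h3 | h4
    · subst h3
      exact t31_le_t22 (.par s t)
    · exact (row_iff (.par s t) a (by omega)).2 (sum_phi_row_par s t a h4
        (fun m hm hma => (row_iff s m (by omega)).1 (t_row1 s m hm))
        (fun m hm hma => (row_iff t m (by omega)).1 (t_row1 t m hm)))

/-- the same in the vocabulary of `Tail2DP2Series`: `stat s (a ≤ r ∧ 1 ≤ b) ≤ stat s (a−1 ≤ r ∧ 2 ≤ b)` -/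
theorem stat_t_row1 (s : V2Closure.SP) (a : ℕ) (ha : 3 ≤ a) :
    stat s (fun r b => a ≤ r ∧ 1 ≤ b) ≤ stat s (fun r b => a - 1 ≤ r ∧ 2 ≤ b) :=
  t_row1 s a ha

/-- the count form: `0 ≤ Σ phi a 1` on every pattern for every `a ≥ 3` -/
theorem SP.sum_phi_row_nonneg (s : V2Closure.SP) (a : ℕ) (ha : 3 ≤ a) :
    0 ≤ ∑ x, phi a 1 (s.rLab x) (s.bLab x) :=
  (row_iff s a (by omega)).1 (t_row1 s a ha)

/-- the members `(9,1)`, `(10,1)`, … in the form of the landed ones, e.g. `T(9,1) ≤ T(8,2)` -/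
theorem t91_le_t82 (s : V2Closure.SP) :
    (Finset.univ.filter (fun y : s.Conf => 9 ≤ s.rLab y ∧ 1 ≤ s.bLab y)).card
      ≤ (Finset.univ.filter (fun y : s.Conf => 8 ≤ s.rLab y ∧ 2 ≤ s.bLab y)).card :=
  t_row1 s 9 (by norm_num)

end Summit.Ventures.PercRepro2.Tail2D
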